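import Mathlib.Analysis.Calculus.MeanValue
import Literature.Probability.Percolation.LongRangeSharpnessMeanField
import Literature.Probability.Percolation.LongRangeSimonLieb
import Literature.Probability.LatticeModels.StarComponents
import HarnessLib

/-!
# Sharpness for long-range percolation, III: percolation above the mean-field threshold

Topic `Literature/Probability/Percolation`. Third part of the Duminil-Copin–Tassion (CMP 343 (2016),
§1) proof of sharpness for the long-range kernel model `kernelPercolation J β` on `ℤ^d`: from the
finite-volume differential inequality of `LongRangeSharpnessMeanField.lean` (DCT Lemma 1.4) to
**item 1 of DCT Thm. 1.1 with the mean-field threshold**: if `b ψ_b(S) ≥ 1` for every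
`b ∈ [β₁, β₂]` and every finite `S ∋ 0`, then `ℙ_{β₂}(|K(0)| = ∞) ≥ 1 - e^{-(β₂-β₁)/β₂} > 0`
(DCT §1.3: "Integrating (1.7) between `β̃_c` and `β` implies `ℙ[0 ↔ Λ^c] = f(β) ≥ (β-β̃_c)/β` for
every `Λ ⊆ V`. By letting `Λ` tend to `V`, we obtain (1.5)"; we integrate the inequality with a
constant lower bound, which gives the exponential form, equally positive).

* `one_sub_le_mul_exp_of_deriv_ge` — the ODE comparison `f' ≥ c(1-f) ⇒ 1 - f(b) ≤ (1-f(a))e^{-c(b-a)}`;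
* `kernelPsi J β S = ψ_β(S) = Σ_{x ∈ S} Σ_{y ∉ S} J_{xy} ℙ_β(0 ↔ x in S)` (so that `φ_β(S) ≤ β ψ_β(S)`),
  `kernelTail` (truncation error `Σ_{x ∈ S} Σ_{y ∉ T} J_{xy}`), `kernelPsi_sub_kernelTail_le`
  (`ψ^T ≥ ψ - τ_T`), `tendsto_kernelTail_box` (`τ_{Λ_N} → 0`);
* `ExitOut B z` (`{z ↔ B^c}`), first-exit lemmas, `iInter_setOf_exitOut_box`
  (`⋂_n {0 ↔ Λ_n^c} = {|K(0)| = ∞}`), `iUnion_setOf_exitVia_box` (the truncations exhaust it);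
* `one_sub_real_exitVia_le` (finite volume, DCT (1.7) integrated), `one_sub_real_exitOut_le`
  (`T = Λ_N ↑ ℤ^d`, DCT (1.5) for every `Λ`), **`one_sub_exp_le_real_percolatesAt`** (`Λ ↑ ℤ^d`).

## References

* [DuminilCopinTassionCMP2016] H. Duminil-Copin, V. Tassion, Comm. Math. Phys. 343 (2016)
  725–745, arXiv:1502.03050: Thm. 1.1 (item 1), §1.3 ((1.5), (1.7)), Remark 1.1.
* [Hutchcroft2022] T. Hutchcroft, J. Math. Phys. 63 (2022), arXiv:2202.07634, Prop. 2.4 / 2.7.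
-/

noncomputable section

namespace Literature.Probability.Percolation

open MeasureTheory Finset Literature.Probability.LatticeModels


section Supercritical

variable {d : ℕ}

/-! ### The ODE comparison -/

/-- **Integrating the differential inequality** (Duminil-Copin–Tassion 2016, (1.7): "Integrating
`f'/(1-f) ≥ 1/β` between `β̃_c` and `β` implies `f(β) ≥ (β - β̃_c)/β`"; here in the exponential
form obtained from a constant lower bound `c`): if `f` is differentiable on `[a, b]` with
`f' ≥ c (1 - f)`, then `1 - f(b) ≤ (1 - f(a)) e^{-c(b-a)}`. [cite: DuminilCopinTassionCMP2016, §1.3 (1.7)] -/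
theorem one_sub_le_mul_exp_of_deriv_ge {f : ℝ → ℝ} {a b c : ℝ} (hab : a ≤ b)
    (hf : ∀ x ∈ Set.Icc a b, ∃ D, HasDerivAt f D x ∧ c * (1 - f x) ≤ D) :
    1 - f b ≤ (1 - f a) * Real.exp (-(c * (b - a))) := by
  choose! D hD hcD using hf
  -- `h x = (1 - f x) e^{c x}` is non-increasing on `[a, b]`
  set h : ℝ → ℝ := fun x => (1 - f x) * Real.exp (x * c) with hh
  have hderiv : ∀ x ∈ Set.Icc a b,
      HasDerivAt h (-D x * Real.exp (x * c) + (1 - f x) * (Real.exp (x * c) * c)) x := by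
    intro x hx
    exact ((hD x hx).const_sub 1).mul (hasDerivAt_mul_const c).exp
  have hanti : AntitoneOn h (Set.Icc a b) := by
    refine antitoneOn_of_deriv_nonpos (convex_Icc a b) ?_ ?_ ?_
    · exact fun x hx => (hderiv x hx).continuousAt.continuousWithinAt
    · rw [interior_Icc]
      exact fun x hx => (hderiv x (Set.Ioo_subset_Icc_self hx)).differentiableAt.differentiableWithinAt
    · rw [interior_Icc]
      intro x hx
      rw [(hderiv x (Set.Ioo_subset_Icc_self hx)).deriv]
      have := hcD x (Set.Ioo_subset_Icc_self hx)
      have hexp : 0 < Real.exp (x * c) := Real.exp_pos _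
      nlinarith
  have hab' := hanti (Set.left_mem_Icc.2 hab) (Set.right_mem_Icc.2 hab) hab
  simp only [hh] at hab'
  -- `(1 - f b) e^{bc} ≤ (1 - f a) e^{ac}`
  have hexpb : 0 < Real.exp (b * c) := Real.exp_pos _
  calc 1 - f b = (1 - f b) * Real.exp (b * c) * Real.exp (-(b * c)) := by
        rw [mul_assoc, ← Real.exp_add, add_neg_cancel, Real.exp_zero, mul_one]
    _ ≤ (1 - f a) * Real.exp (a * c) * Real.exp (-(b * c)) :=
        mul_le_mul_of_nonneg_right hab' (Real.exp_pos _).le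
    _ = (1 - f a) * Real.exp (-(c * (b - a))) := by
        rw [mul_assoc, ← Real.exp_add]; congr 1; ring_nf

/-! ### The untruncated functional `ψ_β(S)` and the truncation error -/

/-- **`ψ_β(S) = Σ_{x ∈ S} Σ_{y ∉ S} J_{xy} ℙ_β(0 ↔ x in S)`**, the `J`-form of Duminil-Copin–Tassion's
`φ_β(S)` (`φ_β(S) ≤ β ψ_β(S)` since `1 - e^{-t} ≤ t`). [cite: DuminilCopinTassionCMP2016, §1.1 (1.1)] -/
def kernelPsi (J : Sym2 (Site d) → ℝ) (β : ℝ) (S : Finset (Site d)) : ℝ :=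
  ∑ x ∈ S, (∑' y : Site d, if y ∈ S then 0 else J s(x, y)) *
    (kernelPercolation J β).real {ω | IntConn S ω 0 x}

/-- The truncation error `τ_T(S) = Σ_{x ∈ S} Σ_{y ∉ T} J_{xy}`. [folklore] -/
def kernelTail (J : Sym2 (Site d) → ℝ) (S T : Finset (Site d)) : ℝ :=
  ∑ x ∈ S, ∑' y : Site d, if y ∈ T then 0 else J s(x, y)

/-- Summability of `y ↦ J_{xy} 𝟙[y ∉ F]` for an integrable kernel. [folklore] -/
theorem summable_kernel_indicator_compl {J : Sym2 (Site d) → ℝ} (hJ : ∀ e, 0 ≤ J e)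
    (hI : IsIntegrableKernel J) (F : Finset (Site d)) (x : Site d) :
    Summable fun y : Site d => if y ∈ F then (0 : ℝ) else J s(x, y) := by
  refine Summable.of_nonneg_of_le (fun y => ?_) (fun y => ?_) (hI x)
  · split_ifs; exacts [le_rfl, hJ _]
  · split_ifs; exacts [hJ _, le_rfl]

/-- `τ_T(S) ≥ 0`. [folklore] -/
theorem kernelTail_nonneg {J : Sym2 (Site d) → ℝ} (hJ : ∀ e, 0 ≤ J e) (S T : Finset (Site d)) :
    0 ≤ kernelTail J S T :=
  Finset.sum_nonneg fun x _ => tsum_nonneg fun y => by split_ifs; exacts [le_rfl, hJ _]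

/-- **Truncation comparison**: for `S ⊆ T`, `ψ^T_β(S) ≥ ψ_β(S) - τ_T(S)`. [folklore] -/
theorem kernelPsi_sub_kernelTail_le {J : Sym2 (Site d) → ℝ} (hJ : ∀ e, 0 ≤ J e)
    (hI : IsIntegrableKernel J) (β : ℝ) {S T : Finset (Site d)} (hST : S ⊆ T) :
    kernelPsi J β S - kernelTail J S T ≤ kernelPsiIn J β S T := by
  unfold kernelPsi kernelTail kernelPsiIn
  rw [← Finset.sum_sub_distrib]
  refine Finset.sum_le_sum fun x hx => ?_
  set P := (kernelPercolation J β).real {ω | IntConn S ω 0 x} with hP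
  have hP0 : 0 ≤ P := measureReal_nonneg
  have hP1 : P ≤ 1 := measureReal_le_one
  -- split `Σ_{y ∉ S} = Σ_{y ∈ T \ S} + Σ_{y ∉ T}`
  have hsplit : (∑' y : Site d, if y ∈ S then (0 : ℝ) else J s(x, y)) =
      (∑ y ∈ T \ S, J s(x, y)) + ∑' y : Site d, if y ∈ T then (0 : ℝ) else J s(x, y) := by
    have h1 : (fun y : Site d => if y ∈ S then (0 : ℝ) else J s(x, y)) =
        (fun y => (if y ∈ T \ S then J s(x, y) else 0) + (if y ∈ T then 0 else J s(x, y))) := by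
      funext y
      simp only [Finset.mem_sdiff]
      by_cases hyS : y ∈ S
      · simp [hyS, hST hyS]
      · by_cases hyT : y ∈ T <;> simp [hyS, hyT]
    rw [h1, Summable.tsum_add ?_ (summable_kernel_indicator_compl hJ hI T x)]
    · rw [tsum_eq_sum (s := T \ S) (fun y hy => if_neg hy)]
      congr 1
      exact Finset.sum_congr rfl fun y hy => if_pos hy
    · exact summable_of_ne_finset_zero (s := T \ S) fun y hy => if_neg hy
  rw [hsplit, add_mul]
  have htail0 : 0 ≤ ∑' y : Site d, if y ∈ T then (0 : ℝ) else J s(x, y) :=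
    tsum_nonneg fun y => by split_ifs; exacts [le_rfl, hJ _]
  nlinarith [mul_le_of_le_one_right htail0 hP1]

/-- `ψ_β(S) ≥ 0`. [folklore] -/
theorem kernelPsi_nonneg {J : Sym2 (Site d) → ℝ} (hJ : ∀ e, 0 ≤ J e) (β : ℝ) (S : Finset (Site d)) :
    0 ≤ kernelPsi J β S :=
  Finset.sum_nonneg fun x _ => mul_nonneg (tsum_nonneg fun y => by split_ifs; exacts [le_rfl, hJ _])
    measureReal_nonneg

/-- The truncation error along the boxes tends to `0`. [folklore] -/
theorem tendsto_kernelTail_box (J : Sym2 (Site d) → ℝ) (S : Finset (Site d)) :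
    Filter.Tendsto (fun N : ℕ => kernelTail J S (box d N)) Filter.atTop (nhds 0) := by
  unfold kernelTail
  suffices key : ∀ x ∈ S, Filter.Tendsto (fun N : ℕ => ∑' y : Site d,
      if y ∈ box d N then (0 : ℝ) else J s(x, y)) Filter.atTop (nhds 0) by
    simpa using tendsto_finsetSum S key
  intro x _
  -- the tail of the summable series `J(x, ·)` along the exhausting boxes
  have hbox : Filter.Tendsto (fun N : ℕ => box d N) Filter.atTop Filter.atTop :=
    Filter.tendsto_atTop_finset_of_monotone (box_mono d) fun y =>
      ⟨boxRadius {y}, subset_box_boxRadius {y} (Finset.mem_singleton_self y)⟩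
  have htail := (tendsto_tsum_compl_atTop_zero fun y : Site d => J s(x, y)).comp hbox
  refine htail.congr fun N => ?_
  simp only [Function.comp_apply]
  have h1 : (∑' a : {y : Site d // y ∉ box d N}, J s(x, (a : Site d))) =
      ∑' y : Site d, ({y : Site d | y ∉ box d N}).indicator (fun y => J s(x, y)) y :=
    tsum_subtype ({y : Site d | y ∉ box d N}) (fun y => J s(x, y))
  rw [h1]
  refine tsum_congr fun y => ?_
  simp only [Set.indicator_apply, Set.mem_setOf_eq]
  by_cases hy : y ∈ box d N <;> simp [hy]

/-! ### The untruncated exit event and its limits -/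

/-- **`{z ↔ B^c}`**: `z` is joined inside `B` to a vertex of `B` with an open edge leaving `B`
(Duminil-Copin–Tassion's `{0 ↔ Λ^c}`). [cite: DuminilCopinTassionCMP2016, §1.1] -/
def ExitOut (B : Finset (Site d)) (z : Site d) (ω : BondConfig (Site d)) : Prop :=
  ∃ x, x ∈ B ∧ IntConn B ω z x ∧ ∃ y, y ∉ B ∧ s(x, y) ∈ ω

/-- A walk of the open graph all of whose vertices lie in `B` is an internal connection. [folklore] -/
theorem intConn_of_walk_support {B : Finset (Site d)} {ω : BondConfig (Site d)} {z x : Site d}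
    (w : (openGraph ω).Walk z x) (hw : ∀ v ∈ w.support, v ∈ B) : IntConn B ω z x := by
  refine ⟨w.transfer (openGraph (ω ∩ ↑(internalEdges B))) fun e he => ?_⟩
  have heω := w.edges_subset_edgeSet he
  induction e using Sym2.ind with
  | h a b =>
    rw [SimpleGraph.mem_edgeSet] at heω ⊢
    rw [openGraph_adj] at heω
    rw [intGraph_adj]
    exact ⟨heω.1, hw a (w.fst_mem_support_of_mem_edges he), hw b (w.snd_mem_support_of_mem_edges he),
      heω.2⟩

/-- **An open path leaving `B` produces an exit** (first exit). [folklore] -/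
theorem exitOut_of_reachable {B : Finset (Site d)} {z y : Site d} (hz : z ∈ B) (hy : y ∉ B)
    {ω : BondConfig (Site d)} (h : (openGraph ω).Reachable z y) : ExitOut B z ω := by
  obtain ⟨w⟩ := h
  obtain ⟨u, v, p₁, -, huv, hp₁, hvB, -⟩ :=
    Walk.exists_exit_decomposition (↑B : Set (Site d)) w (Finset.mem_coe.2 hz) (by simpa using hy)
  simp only [Finset.mem_coe] at hp₁ hvB
  rw [openGraph_adj] at huv
  exact ⟨u, hp₁ u p₁.end_mem_support, intConn_of_walk_support p₁ hp₁, v, hvB, huv.1⟩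

/-- Conversely an exit gives an open path leaving `B`. [folklore] -/
theorem exists_reachable_of_exitOut {B : Finset (Site d)} {z : Site d} {ω : BondConfig (Site d)}
    (h : ExitOut B z ω) : ∃ y, y ∉ B ∧ (openGraph ω).Reachable z y := by
  obtain ⟨x, hxB, hzx, y, hyB, hxy⟩ := h
  refine ⟨y, hyB, ?_⟩
  have hzx' : (openGraph ω).Reachable z x :=
    SimpleGraph.Reachable.mono (openGraph_mono Set.inter_subset_left) hzx
  refine hzx'.trans (SimpleGraph.Adj.reachable ((openGraph_adj ω x y).2 ⟨hxy, fun h => hyB (h ▸ hxB)⟩))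

/-- The exit events of the boxes decrease. [folklore] -/
theorem exitOut_box_antitone (ω : BondConfig (Site d)) :
    Antitone fun n : ℕ => ExitOut (box d n) 0 ω := by
  refine antitone_nat_of_succ_le fun n h => ?_
  obtain ⟨y, hy, hreach⟩ := exists_reachable_of_exitOut h
  exact exitOut_of_reachable (zero_mem_box d n) (fun hy' => hy (box_mono d (Nat.le_succ n) hy')) hreach

/-- **`⋂_n {0 ↔ Λ_n^c} = {|K(0)| = ∞}`** ("we set `0 ↔ ∞` if `0` is connected to `Λ_n^c` for all
`n ≥ 1`"). [cite: DuminilCopinTassionCMP2016, §1.1] -/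
theorem iInter_setOf_exitOut_box :
    (⋂ n : ℕ, {ω : BondConfig (Site d) | ExitOut (box d n) 0 ω}) = percolatesAt 0 := by
  ext ω
  simp only [Set.mem_iInter, Set.mem_setOf_eq]
  constructor
  · intro h hfin
    -- a finite cluster lies in a box
    set K := (hfin : (openCluster ω 0).Finite).toFinset with hK
    obtain ⟨y, hy, hreach⟩ := exists_reachable_of_exitOut (h (boxRadius K))
    exact hy (subset_box_boxRadius K ((Set.Finite.mem_toFinset hfin).2 hreach))
  · intro h n
    have : ¬(openCluster ω 0 ⊆ ↑(box d n)) := fun hsub => h ((box d n).finite_toSet.subset hsub)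
    obtain ⟨y, hy, hyn⟩ := Set.not_subset.1 this
    exact exitOut_of_reachable (zero_mem_box d n) (by simpa using hyn) hy

/-- The truncated exit events increase to the exit event. [folklore] -/
theorem iUnion_setOf_exitVia_box (B : Finset (Site d)) (z : Site d) :
    (⋃ N : ℕ, {ω : BondConfig (Site d) | ExitVia B (box d N) z ω}) = {ω | ExitOut B z ω} := by
  ext ω
  simp only [Set.mem_iUnion, Set.mem_setOf_eq]
  constructor
  · rintro ⟨N, x, hxB, hzx, y, -, hyB, hxy⟩
    exact ⟨x, hxB, hzx, y, hyB, hxy⟩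
  · rintro ⟨x, hxB, hzx, y, hyB, hxy⟩
    exact ⟨boxRadius {y}, x, hxB, hzx, y, subset_box_boxRadius {y} (Finset.mem_singleton_self y),
      hyB, hxy⟩

/-- The truncated exit events are monotone in the truncation. [folklore] -/
theorem exitVia_box_monotone (B : Finset (Site d)) (z : Site d) (ω : BondConfig (Site d)) :
    Monotone fun N : ℕ => ExitVia B (box d N) z ω := by
  intro N N' h ⟨x, hxB, hzx, y, hyT, hyB, hxy⟩
  exact ⟨x, hxB, hzx, y, box_mono d h hyT, hyB, hxy⟩

/-- `{z ↔ B^c}` is measurable. [folklore] -/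
theorem measurableSet_exitOut (B : Finset (Site d)) (z : Site d) :
    MeasurableSet {ω : BondConfig (Site d) | ExitOut B z ω} := by
  rw [← iUnion_setOf_exitVia_box]
  exact MeasurableSet.iUnion fun N => (determinedBy_exitVia B (box d N) z).measurableSet_of_finset

/-! ### Percolation above the mean-field threshold (Duminil-Copin–Tassion 2016, Thm. 1.1, item 1) -/

/-- **Finite volume**: under `b ψ_b(S) ≥ 1` for all `b ∈ [β₁, β₂]` and all finite `S ∋ 0`, for every
finite `B ∋ 0` and `T ⊇ B`,
`1 - ℙ_{β₂}(0 ↔ out) ≤ exp(-(1/β₂ - τ)(β₂ - β₁))` with `τ` the total truncation error of `B` in `T`.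
[cite: DuminilCopinTassionCMP2016, §1.3 (proof of (1.5) from Lemma 1.4)] -/
theorem one_sub_real_exitVia_le {J : Sym2 (Site d) → ℝ} (hJ : ∀ e, 0 ≤ J e)
    (hI : IsIntegrableKernel J) {β₁ β₂ : ℝ} (hβ₁ : 0 < β₁) (h12 : β₁ ≤ β₂)
    (H : ∀ b ∈ Set.Icc β₁ β₂, ∀ S : Finset (Site d), (0 : Site d) ∈ S → 1 / b ≤ kernelPsi J b S)
    {B T : Finset (Site d)} (h0 : (0 : Site d) ∈ B) (hBT : B ⊆ T) :
    1 - (kernelPercolation J β₂).real {ω | ExitVia B T 0 ω} ≤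
      Real.exp (-((1 / β₂ - ∑ S ∈ B.powerset, kernelTail J S T) * (β₂ - β₁))) := by
  set τ := ∑ S ∈ B.powerset, kernelTail J S T with hτ
  have key := one_sub_le_mul_exp_of_deriv_ge (f := fun b => (kernelPercolation J b).real
      {ω | ExitVia B T 0 ω}) (c := 1 / β₂ - τ) h12 (by
    intro b hb
    have hb0 : 0 < b := lt_of_lt_of_le hβ₁ hb.1
    refine hasDerivAt_real_exitVia_ge hJ hb0 h0 (m := 1 / β₂ - τ) fun S hS h0S => ?_
    have hSB : S ⊆ B := Finset.mem_powerset.1 hS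
    have h1 : 1 / β₂ ≤ 1 / b := one_div_le_one_div_of_le hb0 hb.2
    have h2 : kernelTail J S T ≤ τ :=
      Finset.single_le_sum (f := fun S => kernelTail J S T) (fun S _ => kernelTail_nonneg hJ S T) hS
    have h3 := kernelPsi_sub_kernelTail_le hJ hI b (hSB.trans hBT)
    have h4 := H b hb S h0S
    linarith)
  refine le_trans key ?_
  have h1 : 1 - (kernelPercolation J β₁).real {ω | ExitVia B T 0 ω} ≤ 1 := by
    linarith [measureReal_nonneg (μ := kernelPercolation J β₁) (s := {ω | ExitVia B T 0 ω})]
  have h0' : 0 ≤ 1 - (kernelPercolation J β₁).real {ω | ExitVia B T 0 ω} := by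
    linarith [measureReal_le_one (μ := kernelPercolation J β₁) (s := {ω | ExitVia B T 0 ω})]
  exact mul_le_of_le_one_left (Real.exp_pos _).le h1

/-- **Infinite volume exits**: under the same hypothesis, `1 - ℙ_{β₂}(0 ↔ B^c) ≤ exp(-(β₂-β₁)/β₂)`
for every finite `B ∋ 0` ("`ℙ[0 ↔ Λ^c] = f(β) ≥ (β - β̃_c)/β` for every `Λ`").
[cite: DuminilCopinTassionCMP2016, §1.3 (1.5)] -/
theorem one_sub_real_exitOut_le {J : Sym2 (Site d) → ℝ} (hJ : ∀ e, 0 ≤ J e)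
    (hI : IsIntegrableKernel J) {β₁ β₂ : ℝ} (hβ₁ : 0 < β₁) (h12 : β₁ ≤ β₂)
    (H : ∀ b ∈ Set.Icc β₁ β₂, ∀ S : Finset (Site d), (0 : Site d) ∈ S → 1 / b ≤ kernelPsi J b S)
    {B : Finset (Site d)} (h0 : (0 : Site d) ∈ B) :
    1 - (kernelPercolation J β₂).real {ω | ExitOut B 0 ω} ≤ Real.exp (-((β₂ - β₁) / β₂)) := by
  set μ := kernelPercolation J β₂ with hμ
  -- the truncations `T = Λ_N`, `N → ∞`
  have hlim_f : Filter.Tendsto (fun N : ℕ => 1 - μ.real {ω | ExitVia B (box d N) 0 ω})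
      Filter.atTop (nhds (1 - μ.real {ω | ExitOut B 0 ω})) := by
    refine Filter.Tendsto.const_sub 1 ?_
    have hmono : Monotone fun N : ℕ => {ω : BondConfig (Site d) | ExitVia B (box d N) 0 ω} :=
      fun N N' h ω hω => exitVia_box_monotone B 0 ω h hω
    have := tendsto_measure_iUnion_atTop (μ := μ) hmono
    rw [iUnion_setOf_exitVia_box] at this
    exact (ENNReal.tendsto_toReal (measure_ne_top _ _)).comp this
  have hlim_g : Filter.Tendsto (fun N : ℕ =>
      Real.exp (-((1 / β₂ - ∑ S ∈ B.powerset, kernelTail J S (box d N)) * (β₂ - β₁))))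
      Filter.atTop (nhds (Real.exp (-((β₂ - β₁) / β₂)))) := by
    have hτ : Filter.Tendsto (fun N : ℕ => ∑ S ∈ B.powerset, kernelTail J S (box d N))
        Filter.atTop (nhds 0) := by
      simpa using tendsto_finsetSum B.powerset fun S _ => tendsto_kernelTail_box J S
    have : Filter.Tendsto (fun N : ℕ => -((1 / β₂ - ∑ S ∈ B.powerset, kernelTail J S (box d N)) *
        (β₂ - β₁))) Filter.atTop (nhds (-((1 / β₂ - 0) * (β₂ - β₁)))) :=
      ((tendsto_const_nhds.sub hτ).mul tendsto_const_nhds).neg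
    have hβ₂ : β₂ ≠ 0 := (lt_of_lt_of_le hβ₁ h12).ne'
    rw [show -((1 / β₂ - 0) * (β₂ - β₁)) = -((β₂ - β₁) / β₂) by rw [sub_zero]; ring] at this
    exact (Real.continuous_exp.tendsto _).comp this
  -- the inequality holds for every `N` with `B ⊆ Λ_N`
  refine le_of_tendsto_of_tendsto hlim_f hlim_g ?_
  rw [Filter.EventuallyLE, Filter.eventually_atTop]
  refine ⟨boxRadius B, fun N hN => ?_⟩
  exact one_sub_real_exitVia_le hJ hI hβ₁ h12 H h0 ((subset_box_boxRadius B).trans (box_mono d hN))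

/-- **Percolation above the mean-field threshold** (Duminil-Copin–Tassion 2016, Thm. 1.1 item 1 with
`β̃_c`, proof in §1.3: "By letting `Λ` tend to `V`, we obtain `ℙ[0 ↔ ∞] ≥ (β - β̃_c)/β`"; here in
the exponential form `1 - e^{-(β₂-β₁)/β₂}` and for the long-range kernel model on `ℤ^d`): if
`b ψ_b(S) ≥ 1` for every `b ∈ [β₁, β₂]` (`0 < β₁ ≤ β₂`) and every finite `S ∋ 0`, then
`θ(β₂) = ℙ_{β₂}(|K(0)| = ∞) ≥ 1 - e^{-(β₂-β₁)/β₂} > 0`.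
[cite: DuminilCopinTassionCMP2016, Thm. 1.1 (item 1) and §1.3] -/
theorem one_sub_exp_le_real_percolatesAt {J : Sym2 (Site d) → ℝ} (hJ : ∀ e, 0 ≤ J e)
    (hI : IsIntegrableKernel J) {β₁ β₂ : ℝ} (hβ₁ : 0 < β₁) (h12 : β₁ ≤ β₂)
    (H : ∀ b ∈ Set.Icc β₁ β₂, ∀ S : Finset (Site d), (0 : Site d) ∈ S → 1 / b ≤ kernelPsi J b S) :
    1 - Real.exp (-((β₂ - β₁) / β₂)) ≤ (kernelPercolation J β₂).real (percolatesAt (0 : Site d)) := by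
  set μ := kernelPercolation J β₂ with hμ
  have hanti : Antitone fun n : ℕ => {ω : BondConfig (Site d) | ExitOut (box d n) 0 ω} :=
    fun n n' h ω hω => exitOut_box_antitone ω h hω
  have hlim := tendsto_measure_iInter_atTop (μ := μ)
    (fun n => (measurableSet_exitOut (box d n) 0).nullMeasurableSet) hanti ⟨0, measure_ne_top _ _⟩
  rw [iInter_setOf_exitOut_box] at hlim
  have hlim' : Filter.Tendsto (fun n : ℕ => μ.real {ω | ExitOut (box d n) 0 ω}) Filter.atTop
      (nhds (μ.real (percolatesAt 0))) := (ENNReal.tendsto_toReal (measure_ne_top _ _)).comp hlim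
  refine ge_of_tendsto hlim' (Filter.Eventually.of_forall fun n => ?_)
  have := one_sub_real_exitOut_le hJ hI hβ₁ h12 H (zero_mem_box d n)
  linarith

end Supercritical

end Literature.Probability.Percolation

end
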